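import Mathlib
import Literature.MathematicalPhysics.QuantumFieldTheory.Balaban1983to89.B4Strip

/-!
# `Balaban1983to89.B4ContourShift` — the "analyticity method of proving an exponential decay" (B4 p. 586 l. 11–15,
# B5 p. 38) as a KERNEL THEOREM: contour shift on `[-π,π] × [0,σ]` ⇒ `|K(x)| ≤ M e^{-κ|x|_∞}` for strip-regular multipliers

T. Bałaban, *Regularity and decay of lattice Green's functions*, Commun. Math. Phys. **89**, 571–597 (1983)
[Balaban1983RegularityDecay] (cell paper B4), p. 586 [PDF 16], l. 11–15; T. Bałaban, *Propagators and renormalization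
transformations for lattice gauge theories. I*, Commun. Math. Phys. **95**, 17–40 (1984) [Balaban1984PropagatorsI] (cell paper
B5), p. 38 [PDF 22]; printed precedent K. Gawędzki, A. Kupiainen, *A rigorous block spin approach to massless lattice
theories*, Commun. Math. Phys. **77**, 31–64 (1980) [GawedzkiKupiainen1980], Appendix, Proposition A.2, p. 60.

CITATION HEADER (lean-in-tree rule 2026-08-18).  This module is a SUPPLEMENT to the sibling modules `…Balaban1983to89.B4Strip`
(imported: the complexified momenta `ofRealVec`, the polystrip `Strip d κ = {p ∈ ℂ^d : |Re p_μ| ≤ π, |Im p_μ| ≤ κ}`, the typed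
strip statement `UniformStrip`), `…B4StripCauchy` (`uniformStrip_holds`: the j-uniform strip bound of B4 p. 586 l. 9–11 is a
theorem), `…B5Strip145` / `…B5Strip145Leaves` (`uniformStrip145_holds`: the k-uniform strip bound for the multiplier (1.45) of
B5).  It is NOT a quotation of the papers.  After the strip bound, B4 concludes (p. 586 [PDF 16] l. 11–15, VERBATIM):
"Shifting the domain of integration in (2.49) into a complex domain in the direction of the vector x′ − y, we can bound the
left hand side of (2.49) by a constant depending on α multiplied by the exponential factor e^{−δ₀|x′−y|} = e^{−δ₀dist({x,x′},y)}.
We get the inequality (2.36).  The inequalities (2.35) are proved in the same way and constants depend on d only."  B5 inherits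
the step by reference (p. 38 [PDF 22], VERBATIM): "Let us write bounds for the operator ∂P∂*. They follow from the representation
P = G′Q′*(Q′G′²Q′*)⁻¹Q′G′, from Lemma 2.4 of [2], and the representation (1.45) and the analyticity method of proving an
exponential decay (see the proof of Lemma 2.4 in [2]). We obtain |(∂P∂*)_{μ,ν}(x, x′)| ≤ O(1)e^{−δ′₀|x−x′|}, (1.126) […] The
constant O(1) in (1.126) depends on d only".  Neither paper writes the shift out; the printed precedent is GK 1980, proof of
Prop. A.2, p. 60 (VERBATIM, held text `paper:doi-10-1007-bf01205038` p. 30): "By Lemma A.1 (b) and (c) G_m(p)^{−1} is analytic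
in p₀ for |Im p₀| < ε and bounded uniformly in m, Re p ∈ [−π, π]^d and Λ. Thus [display] which establishes exponential falloff
of this kernel in zero direction, by symmetry in all coordinate directions and by |x − y| ≤ C max|x_μ − y_μ| in all
directions."  The cell `pub-balaban` located the step as (S3) of the B4 p. 586 census and supplied it in prose
(`HOME/b2b-balaban-b04-g2/StripLemma.md`, Lemma E (E1)–(E2); `HOME/b2b-balaban-b05-g2/QGGQ-strip-census.md` §3 for B5; GAPS
rows C-B5-18 / C-B5-18K: "NOT TYPED … the Paley–Wiener / contour-shift step"), and the tree modules `B4Strip` ((S3) left to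
"StripLemma.md D–E"), `B5Strip145`, `B5Strip145Leaves` stop at the strip bound.  THIS FILE PROVES THE STEP IN THE KERNEL, in
the one-direction-at-a-time form of GK p. 60, for an ARBITRARY multiplier `G : ℂ^{d+1} → ℂ`:

 * §1 CONTOUR SHIFT `integral_shift` [(E2) "Cauchy's theorem applied coordinate by coordinate to a 2π-periodic analytic
   function on the rectangle [−π, π] × [0, q_μ] (the two vertical sides cancel by periodicity)"]: `g` continuous on
   `[-π,π] × [-κ,κ]`, holomorphic inside, equal values on the vertical sides ⇒ `∫_{-π}^{π} g(t) dt = ∫_{-π}^{π} g(t + iσ) dt`,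
   `|σ| ≤ κ` — from Mathlib's Cauchy–Goursat theorem for rectangles
   `Complex.integral_boundary_rect_eq_zero_of_continuousOn_of_differentiableOn`.
 * §2 ONE VARIABLE `norm_fourier_le`: with `|g| ≤ M` on the closed rectangle, `|∫_{-π}^{π} g(t) e^{itx} dt| ≤ 2π M e^{−κ|x|}`
   for `x ∈ ℤ` (shift by `σ = κ sgn x`; `|e^{i(t+iσ)x}| = e^{−σx}`; the character `e^{itx}` itself matches on the sides,
   `side_char`).
 * §3 `d+1` VARIABLES, ONE DIRECTION `norm_fourierBox_le_coord` ["in zero direction"]: the box integral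
   `fourierBox G x = ∫_{[-π,π]^{d+1}} G(p) e^{ip·x} dp` is written as an iterated integral singling out coordinate `i`
   (`fourierBox_eq_iterated`, Fubini through `MeasureTheory.volume_preserving_piFinSuccAbove`, the template of Mathlib's
   `torusIntegral_succAbove`), and slice regularity in direction `i` (`SliceRegular G i κ M`: every slice
   `z ↦ G(q₁,…,z,…,q_d)` through a REAL point `q ∈ [-π,π]^d` is continuous on the closed rectangle, holomorphic inside,
   side-matching, bounded by `M`) gives `|fourierBox G x| ≤ (2π)^{d+1} M e^{−κ|x_i|}`.
 * §4 ALL DIRECTIONS ["by symmetry in all coordinate directions and by |x − y| ≤ C max|x_μ − y_μ|"]: `supNorm`,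
   `norm_fourierBox_le`, and for the normalised kernel `latticeKernel G x = (2π)^{−(d+1)} fourierBox G x` the bound
   `norm_latticeKernel_le : |K(x)| ≤ M e^{−κ|x|_∞}`; the consumer INTERFACE `StripRegular G κ M` (continuity of `G` on
   `B4Strip.Strip (d+1) κ`, slice holomorphy on the open rectangles, side matching — e.g. from `2π`-periodicity,
   `sides_of_periodic` —, `|G| ≤ M` on the strip) with `StripRegular.sliceRegular`, `StripRegular.integrableOn`, and the
   headline theorems `latticeKernel_decay : StripRegular G κ M → 0 ≤ κ → |K(x)| ≤ M e^{−κ|x|_∞}` and the Euclidean form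
   `latticeKernel_decay_euclid : |K(x)| ≤ M e^{−(κ/√(d+1))|x|₂}` (`0 ≤ M`).
 * §5 CLOSURE (v2; the shape of the instantiations): `StripRegular.mono`, `.of_le` (narrower strip), `stripRegular_const`,
   `.mul`, `.add`, and `stripRegular_inv` — a symbol `F` continuous on the strip, slice holomorphic, side matching and
   BOUNDED BELOW, `|F| ≥ c > 0` (the form in which `B4StripCauchy.uniformStrip_holds` delivers `E` and
   `B5Strip145Leaves.uniformStrip145_holds` delivers `m(p′) = 𝒩/E²`), has `1/F` strip regular with bound `1/c`; whence
   `latticeKernel_inv_decay : |((2π)^{-(d+1)} ∫ F(p)⁻¹ e^{ip·x} dp)| ≤ c⁻¹ e^{−κ|x|_∞}`.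
Inputs: Mathlib only (Cauchy–Goursat on rectangles, Fubini/`piFinSuccAbove`, `norm_setIntegral_le_of_norm_le_const`) and the
DEFINITIONS `ofRealVec`, `Strip` of `B4Strip`.  NO published theorem is used as a hypothesis, NO statement of the series is
asserted, no `…Printed` Prop of the sibling modules is used.  No `sorry`, no axiom, no `opaque`.
DIMENSION CONVENTION: the lattice is `ℤ^{d+1}` (`Fin (d+1)`, so that the coordinate set is nonempty); B4's `d ≥ 1` is this
file's `d+1`.
NOT IN SCOPE (stay where the cell records have them): (a) the INSTANTIATIONS — `G` = the integrand `I⁰`, `I^μ` of (2.48)/(2.49)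
(B4 (S2), the residue sums `M̃_l`: StripLemma.md Lemma D, markdown) and `G = 1/m(p′)` of B5 (1.45) (strip bound in tree,
`B5Strip145Leaves.uniformStrip145_holds`; continuity / side matching / slice holomorphy of `1/mReg` on the strip as a
`StripRegular` instance is NOT typed here — its symbol-side inputs are the cell node C-B5-18-INPUTS-KERNEL, module `B5Strip145Analytic`, and the joiner `B5Strip145Decay` applies `stripRegular_inv`); (b) the finite-torus POISSON PERIODISATION
(QGGQ-strip-census.md §3: on `T^{(k)}` the kernel is the periodisation of the `ℤ^{d}`-kernel bounded here); (c) the Hölder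
quotient (2.36) [(E3)] and the reflections (2.42) [(E4)]; (d) the `ℓ¹`-rate form of (E2) (all coordinates shifted at once,
which needs holomorphy of slices through COMPLEX base points): here one direction at a time exactly as GK p. 60, so the rate
is `κ` in the sup norm, `κ/√(d+1)` in the Euclidean norm (DIVERGENCE D-pv17-8 in the cell records; immaterial — (2.35)/(1.126)
assert `∃ δ₀ > 0` depending on `d` only).  VALUE: kernel certificate (generic engine) of a located, printed-by-assertion,
load-bearing step of B4 Lemma 2.4 / B5 (1.126); it is NOT a result of the papers and NOT progress on any summit.  Unit
`b2b-balaban-pv17` (surge node prover #17, gen 2).  Staged byte-identically in the cell package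
`run/shared/lean/pub/pub-balaban/lean/BalabanYm4/Literature/MathematicalPhysics/QuantumFieldTheory/Balaban1983to89/B4ContourShift.lean`.
Companion records: StripLemma.md Lemma E (prose, B04 gen 2), QGGQ-strip-census.md §3 (B05 gen 2), GAPS.md rows C-B5-18 /
C-B5-18K / C-pv17-26 (this unit), DIVERGENCE D-pv17-8.
-/

namespace Literature.MathematicalPhysics.QuantumFieldTheory.Balaban1983to89.B4ContourShift

open Complex Set MeasureTheory intervalIntegral
open Literature.MathematicalPhysics.QuantumFieldTheory.Balaban1983to89.B4Strip (ofRealVec Strip reVec)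
open scoped Real Interval

noncomputable section

/-! ### §1. One variable: the contour shift for a function with matching vertical sides -/

/-- The closed rectangle `[-π, π] × [-κ, κ]` in `ℂ`. [folklore] -/
def closedRect (κ : ℝ) : Set ℂ := [[-π, π]] ×ℂ [[-κ, κ]]

/-- The open rectangle `(-π, π) × (-κ, κ)` in `ℂ`. [folklore] -/
def openRect (κ : ℝ) : Set ℂ := Ioo (-π) π ×ℂ Ioo (-κ) κ

/-- `y` between `0` and `σ` has `|y| ≤ |σ|`. [folklore] -/
theorem abs_le_of_mem_uIcc_zero {y σ : ℝ} (hy : y ∈ [[(0:ℝ), σ]]) : |y| ≤ |σ| := by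
  rcases mem_uIcc.mp hy with ⟨h1, h2⟩ | ⟨h1, h2⟩
  · rw [abs_of_nonneg h1, abs_of_nonneg (h1.trans h2)]; exact h2
  · rw [abs_of_nonpos h2, abs_of_nonpos (h1.trans h2)]; linarith

/-- `y` strictly between `0` and `σ` with `|σ| ≤ κ` lies in `(-κ, κ)`. [folklore] -/
theorem mem_Ioo_of_mem_Ioo_zero {y σ κ : ℝ} (hσ : |σ| ≤ κ)
    (hy : y ∈ Ioo (min (0:ℝ) σ) (max (0:ℝ) σ)) : y ∈ Ioo (-κ) κ := by
  have h1 := (abs_le.mp hσ).1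
  have h2 := (abs_le.mp hσ).2
  rcases le_total 0 σ with h | h
  · rw [min_eq_left h, max_eq_right h] at hy
    exact ⟨by linarith [hy.1], by linarith [hy.2]⟩
  · rw [min_eq_right h, max_eq_left h] at hy
    exact ⟨by linarith [hy.1], by linarith [hy.2]⟩

/-- CONTOUR SHIFT.  If `g` is continuous on the closed rectangle `[-π,π] × [-κ,κ]`, holomorphic on its interior, and takes
the same values on the two vertical sides (e.g. `g` is `2π`-periodic), then the integral of `g` over the horizontal segment
`[-π, π]` equals its integral over the shifted segment `[-π, π] + iσ` for every `|σ| ≤ κ` (Cauchy–Goursat on the rectangle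
`[-π, π] × [0, σ]`: the two vertical sides cancel). [folklore] -/
theorem integral_shift (g : ℂ → ℂ) {κ σ : ℝ} (hσ : |σ| ≤ κ)
    (hc : ContinuousOn g (closedRect κ)) (hd : DifferentiableOn ℂ g (openRect κ))
    (hside : ∀ y : ℝ, |y| ≤ κ → g (-π + y * I) = g (π + y * I)) :
    ∫ t in (-π)..π, g t = ∫ t in (-π)..π, g (t + σ * I) := by
  have hκ : 0 ≤ κ := (abs_nonneg σ).trans hσ
  set z : ℂ := ((-π : ℝ) : ℂ) with hz
  set w : ℂ := (π : ℂ) + σ * I with hw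
  have hzre : z.re = -π := by simp [hz]
  have hzim : z.im = 0 := by simp [hz]
  have hwre : w.re = π := by simp [hw]
  have hwim : w.im = σ := by simp [hw]
  have hsub1 : [[(0:ℝ), σ]] ⊆ [[-κ, κ]] := by
    intro y hy
    have := abs_le_of_mem_uIcc_zero hy
    rw [uIcc_of_le (by linarith : -κ ≤ κ)]
    exact ⟨by linarith [(abs_le.mp (this.trans hσ)).1], (le_abs_self y).trans (this.trans hσ)⟩
  have Hc : ContinuousOn g ([[z.re, w.re]] ×ℂ [[z.im, w.im]]) := by
    rw [hzre, hwre, hzim, hwim]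
    refine hc.mono ?_
    intro u hu
    exact ⟨hu.1, hsub1 hu.2⟩
  have Hd : DifferentiableOn ℂ g
      (Ioo (min z.re w.re) (max z.re w.re) ×ℂ Ioo (min z.im w.im) (max z.im w.im)) := by
    rw [hzre, hwre, hzim, hwim]
    refine hd.mono ?_
    intro u hu
    have h1 : min (-π) π = -π := min_eq_left (by linarith [Real.pi_pos])
    have h2 : max (-π) π = π := max_eq_right (by linarith [Real.pi_pos])
    rw [h1, h2] at hu
    exact ⟨hu.1, mem_Ioo_of_mem_Ioo_zero hσ hu.2⟩
  have key := Complex.integral_boundary_rect_eq_zero_of_continuousOn_of_differentiableOn g z w Hc Hd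
  have hvert : (∫ y : ℝ in z.im..w.im, g (w.re + y * I)) = ∫ y : ℝ in z.im..w.im, g (z.re + y * I) := by
    rw [hzre, hwre, hzim, hwim]
    refine intervalIntegral.integral_congr ?_
    intro y hy
    have : |y| ≤ κ := (abs_le_of_mem_uIcc_zero hy).trans hσ
    have e := hside y this
    push_cast
    exact e.symm
  rw [hvert] at key
  have h0 : (∫ x : ℝ in z.re..w.re, g (x + z.im * I)) = ∫ x : ℝ in (-π)..π, g x := by
    rw [hzre, hwre, hzim]
    congr 1; ext x; simp
  have h1 : (∫ x : ℝ in z.re..w.re, g (x + w.im * I)) = ∫ x : ℝ in (-π)..π, g (x + σ * I) := by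
    rw [hzre, hwre, hwim]
  rw [h0, h1] at key
  have : (∫ x : ℝ in (-π)..π, g x) - (∫ x : ℝ in (-π)..π, g (x + σ * I)) = 0 := by
    simpa using key
  exact sub_eq_zero.mp this


/-! ### §2. One variable: exponential decay of the Fourier coefficients -/

/-- the hypotheses of §1 are stable under multiplication by the character `e^{i z x}`, `x ∈ ℤ`:
matching vertical sides. [folklore] -/
theorem side_char (x : ℤ) (y : ℝ) :
    cexp (I * (π + y * I) * x) = cexp (I * (-π + y * I) * x) := by
  have : I * (π + y * I) * x = I * (-π + y * I) * x + x * (2 * π * I) := by ring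
  rw [this, Complex.exp_add, Complex.exp_int_mul_two_pi_mul_I, mul_one]

/-- modulus of the character on the shifted contour: `|e^{i(t+iσ)x}| = e^{-σx}`. [folklore] -/
theorem norm_char_shift (x : ℤ) (t σ : ℝ) :
    ‖cexp (I * (t + σ * I) * x)‖ = Real.exp (-(σ * x)) := by
  rw [Complex.norm_exp]
  congr 1
  simp [mul_re, mul_im, I_re, I_im]

/-- PALEY–WIENER-TYPE DECAY (one variable).  `g` continuous on `[-π,π] × [-κ,κ]`, holomorphic inside, equal on the two
vertical sides, `|g| ≤ M` on the closed rectangle, `κ ≥ 0`.  Then for every `x ∈ ℤ`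
`|∫_{-π}^{π} g(t) e^{itx} dt| ≤ 2π M e^{-κ|x|}` (shift the contour to `Im z = κ·sgn x`). [folklore] -/
theorem norm_fourier_le (g : ℂ → ℂ) {κ M : ℝ} (hκ : 0 ≤ κ)
    (hc : ContinuousOn g (closedRect κ)) (hd : DifferentiableOn ℂ g (openRect κ))
    (hside : ∀ y : ℝ, |y| ≤ κ → g (-π + y * I) = g (π + y * I))
    (hM : ∀ z ∈ closedRect κ, ‖g z‖ ≤ M) (x : ℤ) :
    ‖∫ t in (-π)..π, g t * cexp (I * t * x)‖ ≤ 2 * π * M * Real.exp (-(κ * |x|)) := by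
  -- the shifted integrand
  set h : ℂ → ℂ := fun z => g z * cexp (I * z * x) with hh
  set σ : ℝ := if 0 ≤ x then κ else -κ with hσdef
  have hσ : |σ| ≤ κ := by
    rw [hσdef]; split_ifs <;> simp [abs_of_nonneg hκ]
  have hσx : σ * x = κ * |x| := by
    rw [hσdef]; split_ifs with hx
    · rw [show ((|x| : ℤ) : ℝ) = (x : ℝ) from by exact_mod_cast abs_of_nonneg hx]
    · have hx : x < 0 := not_le.mp hx
      rw [show ((|x| : ℤ) : ℝ) = -(x : ℝ) from by exact_mod_cast abs_of_neg hx]; ring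
  have hc' : ContinuousOn h (closedRect κ) := by
    refine hc.mul ?_
    exact (Continuous.continuousOn (by fun_prop))
  have hd' : DifferentiableOn ℂ h (openRect κ) := by
    refine hd.mul ?_
    exact (Differentiable.differentiableOn (by fun_prop))
  have hside' : ∀ y : ℝ, |y| ≤ κ → h (-π + y * I) = h (π + y * I) := by
    intro y hy
    simp only [hh]
    rw [hside y hy, side_char x y]
  have shift := integral_shift h hσ hc' hd' hside'
  have e1 : (∫ t in (-π)..π, g t * cexp (I * t * x)) = ∫ t in (-π)..π, h t := by rfl
  rw [e1, shift]
  have hbound : ∀ t ∈ Ι (-π) π, ‖h (t + σ * I)‖ ≤ M * Real.exp (-(κ * |x|)) := by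
    intro t ht
    simp only [hh]
    rw [norm_mul, norm_char_shift, hσx]
    refine mul_le_mul_of_nonneg_right ?_ (Real.exp_pos _).le
    apply hM
    refine ⟨?_, ?_⟩
    · simp only [mem_preimage, add_re, ofReal_re, mul_re, I_re, mul_zero, ofReal_im, I_im, mul_one, sub_self, add_zero]
      rw [uIcc_of_le (by linarith [Real.pi_pos] : -π ≤ π)]
      rw [uIoc_of_le (by linarith [Real.pi_pos] : -π ≤ π)] at ht
      exact ⟨ht.1.le, ht.2⟩
    · simp only [mem_preimage, add_im, ofReal_im, mul_im, I_re, mul_zero, ofReal_re, I_im, mul_one, zero_add, add_zero]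
      rw [uIcc_of_le (by linarith : -κ ≤ κ)]
      exact ⟨(abs_le.mp hσ).1, (abs_le.mp hσ).2⟩
  have := intervalIntegral.norm_integral_le_of_norm_le_const hbound
  calc ‖∫ t in (-π)..π, h (t + σ * I)‖ ≤ M * Real.exp (-(κ * |x|)) * |π - -π| := this
    _ = 2 * π * M * Real.exp (-(κ * |x|)) := by
        rw [show |π - -π| = 2 * π from by rw [sub_neg_eq_add, abs_of_pos (by linarith [Real.pi_pos])]; ring]
        ring


/-! ### §3. `d + 1` variables: the lattice Fourier kernel and the shift in ONE coordinate direction -/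

variable {d : ℕ}

/-- the real Brillouin zone `[-π, π]^d`. [folklore] -/
def BZ (d : ℕ) : Set (Fin d → ℝ) := Icc (fun _ => -π) (fun _ => π)

/-- the phase `p·x = Σ_μ p_μ x_μ` for a momentum `p` and a lattice point `x ∈ ℤ^d`. [folklore] -/
def phase (p : Fin d → ℝ) (x : Fin d → ℤ) : ℂ := ∑ μ, (p μ : ℂ) * (x μ : ℂ)

/-- the integrand `G(p) e^{i p·x}` of the lattice kernel on the real Brillouin zone. [folklore] -/
def integrand (G : (Fin d → ℂ) → ℂ) (x : Fin d → ℤ) (p : Fin d → ℝ) : ℂ :=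
  G (ofRealVec p) * cexp (I * phase p x)

/-- the un-normalised lattice Fourier integral `∫_{[-π,π]^d} G(p) e^{i p·x} dp` (Lebesgue measure on the box). [folklore] -/
def fourierBox (G : (Fin d → ℂ) → ℂ) (x : Fin d → ℤ) : ℂ := ∫ p in BZ d, integrand G x p

/-- the LATTICE KERNEL of the multiplier `G`: `K(x) = (2π)^{-d} ∫_{[-π,π]^d} G(p) e^{i p·x} dp`, `x ∈ ℤ^d` — the kernel of the
translation-invariant operator with Fourier multiplier `G` on `ℓ²(ℤ^d)` (B4 (2.43)–(2.49): the `p′`-integrals over `[-π,π]^d`). [folklore] -/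
def latticeKernel (G : (Fin d → ℂ) → ℂ) (x : Fin d → ℤ) : ℂ := (((2 * π) ^ d)⁻¹ : ℝ) • fourierBox G x

/-- inserting a real coordinate commutes with the passage to complex momenta. [folklore] -/
theorem ofRealVec_insertNth (i : Fin (d + 1)) (t : ℝ) (q : Fin d → ℝ) :
    ofRealVec (i.insertNth t q) = i.insertNth (t : ℂ) (ofRealVec q) := by
  funext j
  refine Fin.succAboveCases i ?_ ?_ j
  · simp [ofRealVec, Fin.insertNth_apply_same]
  · intro k; simp [ofRealVec, Fin.insertNth_apply_succAbove]

/-- splitting the phase at the coordinate `i`: `p·x = t x_i + Σ_{j} q_j x_{i.succAbove j}` for `p = insertNth i t q`. [folklore] -/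
theorem phase_insertNth (i : Fin (d + 1)) (t : ℝ) (q : Fin d → ℝ) (x : Fin (d + 1) → ℤ) :
    phase (i.insertNth t q) x = (t : ℂ) * (x i : ℂ) + phase q (fun j => x (i.succAbove j)) := by
  unfold phase
  rw [Fin.sum_univ_succAbove _ i]
  simp [Fin.insertNth_apply_same, Fin.insertNth_apply_succAbove]

/-- the phase of a real momentum is real. [folklore] -/
theorem phase_eq_ofReal (q : Fin d → ℝ) (y : Fin d → ℤ) : phase q y = ((∑ j, q j * (y j : ℝ) : ℝ) : ℂ) := by
  unfold phase; push_cast; rfl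

/-- `|e^{i q·y}| = 1` for real `q`. [folklore] -/
theorem norm_cexp_phase (q : Fin d → ℝ) (y : Fin d → ℤ) : ‖cexp (I * phase q y)‖ = 1 := by
  rw [phase_eq_ofReal, mul_comm, Complex.norm_exp_ofReal_mul_I]

/-- FUBINI, singling out the coordinate `i`: the box integral over `[-π,π]^{d+1}` is the integral over `q ∈ [-π,π]^d` of the
one-dimensional integrals over the `i`-th coordinate `t ∈ [-π, π]`. [folklore] -/
theorem fourierBox_eq_iterated (G : (Fin (d + 1) → ℂ) → ℂ) (x : Fin (d + 1) → ℤ) (i : Fin (d + 1))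
    (hint : IntegrableOn (integrand G x) (BZ (d + 1))) :
    fourierBox G x = ∫ q in BZ d, ∫ t in Icc (-π) π, integrand G x (i.insertNth t q) := by
  set e : ℝ × (Fin d → ℝ) ≃ᵐ (Fin (d + 1) → ℝ) := (MeasurableEquiv.piFinSuccAbove (fun _ => ℝ) i).symm with he_def
  have hem : MeasurePreserving e :=
    (volume_preserving_piFinSuccAbove (fun _ : Fin (d + 1) => ℝ) i).symm _
  have heπ : (e ⁻¹' Icc (fun _ => -π) fun _ => π) = Icc (-π) π ×ˢ Icc (fun _ : Fin d => -π) (fun _ => π) :=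
    ((Fin.insertNthOrderIso (fun _ => ℝ) i).preimage_Icc _ _).trans (Icc_prod_eq _ _)
  have hint' : IntegrableOn (integrand G x ∘ e) (Icc (-π) π ×ˢ Icc (fun _ : Fin d => -π) (fun _ => π))
      ((volume : Measure ℝ).prod (volume : Measure (Fin d → ℝ))) := by
    have := hint
    rw [BZ, ← hem.integrableOn_comp_preimage e.measurableEmbedding, heπ, Measure.volume_eq_prod] at this
    exact this
  have he : ∀ t q, e (t, q) = i.insertNth t q := by
    intro t q
    simp [he_def, MeasurableEquiv.piFinSuccAbove_symm_apply, Fin.insertNthEquiv]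
  unfold fourierBox
  rw [BZ, ← hem.map_eq, setIntegral_map_equiv, heπ, Measure.volume_eq_prod, ← setIntegral_prod_swap,
    setIntegral_prod (fun z => integrand G x (e z.swap)) (by exact hint'.swap)]
  refine setIntegral_congr_fun measurableSet_Icc fun q _ => ?_
  refine setIntegral_congr_fun measurableSet_Icc fun t _ => ?_
  simp only [Prod.swap_prod_mk, he]

/-- SLICE REGULARITY of the multiplier `G` in the coordinate direction `i` on the strip of half-width `κ`, with bound `M`:
for every real `q ∈ [-π,π]^d` in the remaining coordinates, the slice `z ↦ G(insertNth i z q)` is continuous on the closed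
rectangle `[-π,π] × [-κ,κ]`, holomorphic inside, takes equal values on the two vertical sides (`2π`-periodicity in `p_i`),
and is bounded by `M` in modulus — the hypotheses "analytic … bounded … in this neighbourhood" of B4 p. 586 for ONE direction. [folklore] -/
def SliceRegular (G : (Fin (d + 1) → ℂ) → ℂ) (i : Fin (d + 1)) (κ M : ℝ) : Prop :=
  ∀ q : Fin d → ℝ, q ∈ BZ d →
    ContinuousOn (fun z => G (i.insertNth z (ofRealVec q))) (closedRect κ) ∧
    DifferentiableOn ℂ (fun z => G (i.insertNth z (ofRealVec q))) (openRect κ) ∧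
    (∀ y : ℝ, |y| ≤ κ → G (i.insertNth (-π + y * I) (ofRealVec q)) = G (i.insertNth (π + y * I) (ofRealVec q))) ∧
    (∀ z ∈ closedRect κ, ‖G (i.insertNth z (ofRealVec q))‖ ≤ M)

/-- THE ONE-DIRECTION BOUND.  Under slice regularity in direction `i` (and integrability of the integrand on the box):
`|∫_{[-π,π]^{d+1}} G(p) e^{ip·x} dp| ≤ (2π)^{d+1} M e^{-κ |x_i|}` — "Shifting the domain of integration … into a complex domain in
the direction of the vector x′ − y" (B4 p. 586), done in the `i`-th coordinate; GK 1980 Prop. A.2: "exponential falloff of this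
kernel in zero direction". [folklore] -/
theorem norm_fourierBox_le_coord (G : (Fin (d + 1) → ℂ) → ℂ) (i : Fin (d + 1)) {κ M : ℝ} (hκ : 0 ≤ κ)
    (x : Fin (d + 1) → ℤ) (hint : IntegrableOn (integrand G x) (BZ (d + 1))) (hreg : SliceRegular G i κ M) :
    ‖fourierBox G x‖ ≤ (2 * π) ^ (d + 1) * M * Real.exp (-(κ * |x i|)) := by
  rw [fourierBox_eq_iterated G x i hint]
  -- the inner integrals are bounded uniformly in q
  have hinner : ∀ q ∈ BZ d,
      ‖∫ t in Icc (-π) π, integrand G x (i.insertNth t q)‖ ≤ 2 * π * M * Real.exp (-(κ * |x i|)) := by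
    intro q hq
    obtain ⟨hc, hdiff, hside, hbd⟩ := hreg q hq
    -- the unimodular constant phase of the remaining coordinates, absorbed into the slice
    set C : ℂ := cexp (I * phase q (fun j => x (i.succAbove j))) with hC
    have hCn : ‖C‖ = 1 := norm_cexp_phase q _
    set g : ℂ → ℂ := fun z => G (i.insertNth z (ofRealVec q)) * C with hg
    have hI : (∫ t in Icc (-π) π, integrand G x (i.insertNth t q))
        = ∫ t in (-π)..π, g t * cexp (I * t * (x i)) := by
      rw [intervalIntegral.integral_of_le (by linarith [Real.pi_pos] : -π ≤ π), integral_Icc_eq_integral_Ioc]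
      refine setIntegral_congr_fun measurableSet_Ioc fun t _ => ?_
      simp only [integrand, hg, ofRealVec_insertNth, phase_insertNth, mul_add, Complex.exp_add, hC]
      ring
    rw [hI]
    have hc' : ContinuousOn g (closedRect κ) := hc.mul continuousOn_const
    have hd' : DifferentiableOn ℂ g (openRect κ) := hdiff.mul (differentiableOn_const _)
    have hside' : ∀ y : ℝ, |y| ≤ κ → g (-π + y * I) = g (π + y * I) := by
      intro y hy; simp only [hg]; rw [hside y hy]
    have hM' : ∀ z ∈ closedRect κ, ‖g z‖ ≤ M := by
      intro z hz; simp only [hg]; rw [norm_mul, hCn, mul_one]; exact hbd z hz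
    exact norm_fourier_le g hκ hc' hd' hside' hM' (x i)
  have hvol : volume (BZ d) < ⊤ := by unfold BZ; exact measure_Icc_lt_top
  have := norm_setIntegral_le_of_norm_le_const hvol hinner
  have hreal : volume.real (BZ d) = (2 * π) ^ d := by
    rw [measureReal_def, BZ, Real.volume_Icc_pi_toReal]
    · simp only [sub_neg_eq_add, Finset.prod_const, Finset.card_univ, Fintype.card_fin]; ring
    · intro j; simp only; linarith [Real.pi_pos]
  rw [hreal] at this
  calc ‖∫ q in BZ d, ∫ t in Icc (-π) π, integrand G x (i.insertNth t q)‖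
      ≤ 2 * π * M * Real.exp (-(κ * |x i|)) * (2 * π) ^ d := this
    _ = (2 * π) ^ (d + 1) * M * Real.exp (-(κ * |x i|)) := by ring


/-! ### §4. All directions: sup-norm decay of the lattice kernel; the interface for strip-regular multipliers -/

/-- the sup norm `|x|_∞ = max_i |x_i|` of a lattice vector `x ∈ ℤ^{d+1}`, as a real number. [folklore] -/
def supNorm (x : Fin (d + 1) → ℤ) : ℝ := Finset.univ.sup' Finset.univ_nonempty (fun i => ((|x i| : ℤ) : ℝ))

/-- the sup norm is attained at some coordinate. [folklore] -/
theorem exists_supNorm_eq (x : Fin (d + 1) → ℤ) : ∃ i, supNorm x = ((|x i| : ℤ) : ℝ) := by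
  obtain ⟨i, _, h⟩ := Finset.exists_mem_eq_sup' Finset.univ_nonempty (fun i => ((|x i| : ℤ) : ℝ))
  exact ⟨i, h⟩

/-- each coordinate is bounded by the sup norm. [folklore] -/
theorem abs_le_supNorm (x : Fin (d + 1) → ℤ) (i : Fin (d + 1)) : ((|x i| : ℤ) : ℝ) ≤ supNorm x :=
  Finset.le_sup' (fun i => ((|x i| : ℤ) : ℝ)) (Finset.mem_univ i)

/-- the sup norm is nonnegative. [folklore] -/
theorem supNorm_nonneg (x : Fin (d + 1) → ℤ) : 0 ≤ supNorm x :=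
  le_trans (by positivity) (abs_le_supNorm x 0)

/-- ALL DIRECTIONS ("by symmetry in all coordinate directions", GK 1980 p. 60): slice regularity in every direction gives
`|∫_{[-π,π]^{d+1}} G(p) e^{ip·x} dp| ≤ (2π)^{d+1} M e^{-κ |x|_∞}`. [folklore] -/
theorem norm_fourierBox_le (G : (Fin (d + 1) → ℂ) → ℂ) {κ M : ℝ} (hκ : 0 ≤ κ) (x : Fin (d + 1) → ℤ)
    (hint : IntegrableOn (integrand G x) (BZ (d + 1))) (hreg : ∀ i, SliceRegular G i κ M) :
    ‖fourierBox G x‖ ≤ (2 * π) ^ (d + 1) * M * Real.exp (-(κ * supNorm x)) := by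
  obtain ⟨i, hi⟩ := exists_supNorm_eq x
  rw [hi]
  exact norm_fourierBox_le_coord G i hκ x hint (hreg i)

/-- the same for the normalised lattice kernel: `|K(x)| ≤ M e^{-κ|x|_∞}`. [folklore] -/
theorem norm_latticeKernel_le (G : (Fin (d + 1) → ℂ) → ℂ) {κ M : ℝ} (hκ : 0 ≤ κ) (x : Fin (d + 1) → ℤ)
    (hint : IntegrableOn (integrand G x) (BZ (d + 1))) (hreg : ∀ i, SliceRegular G i κ M) :
    ‖latticeKernel G x‖ ≤ M * Real.exp (-(κ * supNorm x)) := by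
  have h := norm_fourierBox_le G hκ x hint hreg
  have hpos : (0 : ℝ) < (2 * π) ^ (d + 1) := by positivity
  unfold latticeKernel
  rw [norm_smul, Real.norm_eq_abs, abs_of_pos (inv_pos.mpr hpos)]
  calc ((2 * π) ^ (d + 1))⁻¹ * ‖fourierBox G x‖
      ≤ ((2 * π) ^ (d + 1))⁻¹ * ((2 * π) ^ (d + 1) * M * Real.exp (-(κ * supNorm x))) :=
        mul_le_mul_of_nonneg_left h (inv_pos.mpr hpos).le
    _ = M * Real.exp (-(κ * supNorm x)) := by field_simp

/-! #### The interface: multipliers regular on the complex strip `B4Strip.Strip (d+1) κ` -/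

/-- `ofRealVec` is continuous. [folklore] -/
theorem continuous_ofRealVec : Continuous (ofRealVec : (Fin d → ℝ) → (Fin d → ℂ)) :=
  continuous_pi fun μ => Complex.continuous_ofReal.comp (continuous_apply μ)

/-- a real momentum of the Brillouin zone lies in every strip of nonnegative half-width. [folklore] -/
theorem ofRealVec_mem_Strip {κ : ℝ} (hκ : 0 ≤ κ) {p : Fin d → ℝ} (hp : p ∈ BZ d) : ofRealVec p ∈ Strip d κ := by
  intro μ
  refine ⟨?_, by simpa [ofRealVec] using hκ⟩
  simp only [ofRealVec, ofReal_re]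
  exact abs_le.mpr ⟨hp.1 μ, hp.2 μ⟩

/-- inserting a point of the closed rectangle `[-π,π] × [-κ,κ]` at coordinate `i` into a real momentum of `[-π,π]^d` gives a
point of the strip. [folklore] -/
theorem insertNth_mem_Strip {κ : ℝ} (hκ : 0 ≤ κ) (i : Fin (d + 1)) {q : Fin d → ℝ} (hq : q ∈ BZ d)
    {z : ℂ} (hz : z ∈ closedRect κ) : i.insertNth z (ofRealVec q) ∈ Strip (d + 1) κ := by
  intro j
  refine Fin.succAboveCases i ?_ ?_ j
  · rw [Fin.insertNth_apply_same]
    have h1 := hz.1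
    have h2 := hz.2
    simp only [mem_preimage] at h1 h2
    rw [uIcc_of_le (by linarith [Real.pi_pos] : -π ≤ π)] at h1
    rw [uIcc_of_le (by linarith : -κ ≤ κ)] at h2
    exact ⟨abs_le.mpr ⟨h1.1, h1.2⟩, abs_le.mpr ⟨h2.1, h2.2⟩⟩
  · intro k
    rw [Fin.insertNth_apply_succAbove]
    exact ofRealVec_mem_Strip hκ hq k

/-- STRIP-REGULAR MULTIPLIER (the hypotheses of the printed sentence, B4 p. 586 l. 9–11, in the form the cell's strip modules
deliver them): `G` is continuous on the closed strip `Strip (d+1) κ` around the Brillouin zone, each coordinate slice through a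
real point is holomorphic on the open rectangle, the slices take equal values on the vertical sides `Re p_i = ±π`
(`2π`-periodicity), and `|G| ≤ M` on the strip. [folklore] -/
structure StripRegular (G : (Fin (d + 1) → ℂ) → ℂ) (κ M : ℝ) : Prop where
  cont : ContinuousOn G (Strip (d + 1) κ)
  diff : ∀ (i : Fin (d + 1)) (q : Fin d → ℝ), q ∈ BZ d →
    DifferentiableOn ℂ (fun z => G (i.insertNth z (ofRealVec q))) (openRect κ)
  sides : ∀ (i : Fin (d + 1)) (q : Fin d → ℝ), q ∈ BZ d → ∀ y : ℝ, |y| ≤ κ →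
    G (i.insertNth (-π + y * I) (ofRealVec q)) = G (i.insertNth (π + y * I) (ofRealVec q))
  bound : ∀ p ∈ Strip (d + 1) κ, ‖G p‖ ≤ M

/-- `2π`-PERIODICITY in each coordinate (as the trigonometric multipliers of B4/B5 have it, on all of `ℂ^{d+1}`) gives the
side condition. [folklore] -/
theorem sides_of_periodic (G : (Fin (d + 1) → ℂ) → ℂ)
    (hper : ∀ (i : Fin (d + 1)) (p : Fin (d + 1) → ℂ), G (Function.update p i (p i + 2 * π)) = G p)
    (i : Fin (d + 1)) (q : Fin d → ℝ) (y : ℝ) :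
    G (i.insertNth (-π + y * I) (ofRealVec q)) = G (i.insertNth (π + y * I) (ofRealVec q)) := by
  have h := hper i (i.insertNth (-π + y * I) (ofRealVec q))
  rw [← h]
  congr 1
  funext j
  refine Fin.succAboveCases i ?_ ?_ j
  · simp only [Function.update_self, Fin.insertNth_apply_same]; ring
  · intro k
    rw [Function.update_of_ne (Fin.succAbove_ne i k), Fin.insertNth_apply_succAbove, Fin.insertNth_apply_succAbove]

/-- a strip-regular multiplier is slice regular in every direction. [folklore] -/
theorem StripRegular.sliceRegular {G : (Fin (d + 1) → ℂ) → ℂ} {κ M : ℝ} (h : StripRegular G κ M) (hκ : 0 ≤ κ)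
    (i : Fin (d + 1)) : SliceRegular G i κ M := by
  intro q hq
  have hmaps : MapsTo (fun z : ℂ => (i.insertNth z (ofRealVec q) : Fin (d + 1) → ℂ)) (closedRect κ) (Strip (d + 1) κ) :=
    fun z hz => insertNth_mem_Strip hκ i hq hz
  have hcont : Continuous (fun z : ℂ => (i.insertNth z (ofRealVec q) : Fin (d + 1) → ℂ)) := by
    apply Continuous.finInsertNth
    · exact continuous_id
    · exact continuous_const
  refine ⟨h.cont.comp hcont.continuousOn hmaps, h.diff i q hq, h.sides i q hq, ?_⟩
  intro z hz
  exact h.bound _ (hmaps hz)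

/-- a strip-regular multiplier has a continuous, hence integrable, integrand on the compact Brillouin zone. [folklore] -/
theorem StripRegular.integrableOn {G : (Fin (d + 1) → ℂ) → ℂ} {κ M : ℝ} (h : StripRegular G κ M) (hκ : 0 ≤ κ)
    (x : Fin (d + 1) → ℤ) : IntegrableOn (integrand G x) (BZ (d + 1)) := by
  have hc : ContinuousOn (integrand G x) (BZ (d + 1)) := by
    refine ContinuousOn.mul ?_ ?_
    · exact h.cont.comp continuous_ofRealVec.continuousOn fun p hp => ofRealVec_mem_Strip hκ hp
    · refine Continuous.continuousOn ?_
      unfold phase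
      fun_prop
  unfold BZ
  exact hc.integrableOn_compact isCompact_Icc

/-- THE KERNEL THEOREM OF THIS FILE (B4 p. 586 l. 11–15 / B5 p. 38 "the analyticity method of proving an exponential decay" /
GK 1980 Prop. A.2, for translation-invariant multipliers): a strip-regular multiplier with `|G| ≤ M` on the strip of half-width
`κ ≥ 0` has a lattice kernel decaying like `|K(x)| ≤ M e^{-κ |x|_∞}`, `x ∈ ℤ^{d+1}`. [folklore] -/
theorem latticeKernel_decay {G : (Fin (d + 1) → ℂ) → ℂ} {κ M : ℝ} (h : StripRegular G κ M) (hκ : 0 ≤ κ)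
    (x : Fin (d + 1) → ℤ) : ‖latticeKernel G x‖ ≤ M * Real.exp (-(κ * supNorm x)) :=
  norm_latticeKernel_le G hκ x (h.integrableOn hκ x) fun i => h.sliceRegular hκ i

/-- Euclidean form: since `|x|_2 ≤ √(d+1) |x|_∞`, the decay rate in the Euclidean distance is `κ/√(d+1)`:
`|K(x)| ≤ M e^{-(κ/√(d+1)) |x|_2}`. [folklore] -/
theorem latticeKernel_decay_euclid {G : (Fin (d + 1) → ℂ) → ℂ} {κ M : ℝ} (h : StripRegular G κ M) (hκ : 0 ≤ κ)
    (hM : 0 ≤ M) (x : Fin (d + 1) → ℤ) :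
    ‖latticeKernel G x‖ ≤ M * Real.exp (-(κ / Real.sqrt (d + 1) * Real.sqrt (∑ i, ((x i : ℝ)) ^ 2))) := by
  refine (latticeKernel_decay h hκ x).trans ?_
  refine mul_le_mul_of_nonneg_left (Real.exp_le_exp.mpr ?_) hM
  -- need: κ/√(d+1) · |x|_2 ≤ κ · |x|_∞, i.e. |x|_2 ≤ √(d+1) |x|_∞
  have hsq : ∑ i, ((x i : ℝ)) ^ 2 ≤ (d + 1) * supNorm x ^ 2 := by
    calc ∑ i, ((x i : ℝ)) ^ 2 ≤ ∑ _i : Fin (d + 1), supNorm x ^ 2 := by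
          refine Finset.sum_le_sum fun i _ => ?_
          have h1 := abs_le_supNorm x i
          have h2 : ((x i : ℝ)) ^ 2 = (((|x i| : ℤ) : ℝ)) ^ 2 := by rw [Int.cast_abs, sq_abs]
          rw [h2]
          exact pow_le_pow_left₀ (by positivity) h1 2
      _ = (d + 1) * supNorm x ^ 2 := by simp [Finset.sum_const, Finset.card_univ, Fintype.card_fin]
  have hd : (0 : ℝ) < Real.sqrt (d + 1) := Real.sqrt_pos.mpr (by positivity)
  have h2 : Real.sqrt (∑ i, ((x i : ℝ)) ^ 2) ≤ Real.sqrt (d + 1) * supNorm x := by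
    rw [← Real.sqrt_sq (supNorm_nonneg x), ← Real.sqrt_mul (by positivity)]
    exact Real.sqrt_le_sqrt hsq
  have h3 : κ / Real.sqrt (d + 1) * Real.sqrt (∑ i, ((x i : ℝ)) ^ 2) ≤ κ * supNorm x := by
    calc κ / Real.sqrt (d + 1) * Real.sqrt (∑ i, ((x i : ℝ)) ^ 2)
        ≤ κ / Real.sqrt (d + 1) * (Real.sqrt (d + 1) * supNorm x) :=
          mul_le_mul_of_nonneg_left h2 (div_nonneg hκ hd.le)
      _ = κ * supNorm x := by field_simp
  linarith


/-! ### §5. Closure properties of strip regularity (for the instantiations: `1/E`, `1/m(p′) = E²/𝒩`, products of symbols) -/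

/-- the open rectangle is contained in the closed one. [folklore] -/
theorem openRect_subset_closedRect (κ : ℝ) : openRect κ ⊆ closedRect κ := by
  intro z hz
  refine ⟨?_, ?_⟩
  · simp only [mem_preimage]
    rw [uIcc_of_le (by linarith [Real.pi_pos] : -π ≤ π)]
    exact Ioo_subset_Icc_self hz.1
  · have h2 := hz.2
    simp only [mem_preimage] at h2 ⊢
    have hκ : -κ ≤ κ := by linarith [h2.1, h2.2]
    rw [uIcc_of_le hκ]
    exact Ioo_subset_Icc_self h2

/-- a larger bound is still a bound. [folklore] -/
theorem StripRegular.mono {G : (Fin (d + 1) → ℂ) → ℂ} {κ M M' : ℝ} (h : StripRegular G κ M) (hM : M ≤ M') :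
    StripRegular G κ M' :=
  ⟨h.cont, h.diff, h.sides, fun p hp => (h.bound p hp).trans hM⟩

/-- strip regularity on a wide strip gives it on every narrower strip. [folklore] -/
theorem StripRegular.of_le {G : (Fin (d + 1) → ℂ) → ℂ} {κ κ' M : ℝ} (h : StripRegular G κ M) (hκ' : κ' ≤ κ) :
    StripRegular G κ' M := by
  have hS : Strip (d + 1) κ' ⊆ Strip (d + 1) κ := fun p hp μ => ⟨(hp μ).1, (hp μ).2.trans hκ'⟩
  have hR : openRect κ' ⊆ openRect κ := fun z hz =>
    ⟨hz.1, ⟨by linarith [hz.2.1], by linarith [hz.2.2]⟩⟩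
  exact ⟨h.cont.mono hS, fun i q hq => (h.diff i q hq).mono hR, fun i q hq y hy => h.sides i q hq y (hy.trans hκ'),
    fun p hp => h.bound p (hS hp)⟩

/-- CONSTANTS are strip regular. [folklore] -/
theorem stripRegular_const (a : ℂ) (κ : ℝ) : StripRegular (fun _ : Fin (d + 1) → ℂ => a) κ ‖a‖ :=
  ⟨continuousOn_const, fun _ _ _ => differentiableOn_const a, fun _ _ _ _ _ => rfl, fun _ _ => le_rfl⟩

/-- PRODUCTS of strip-regular symbols are strip regular, with the product bound. [folklore] -/
theorem StripRegular.mul {G₁ G₂ : (Fin (d + 1) → ℂ) → ℂ} {κ M₁ M₂ : ℝ} (h₁ : StripRegular G₁ κ M₁)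
    (h₂ : StripRegular G₂ κ M₂) (hM₁ : 0 ≤ M₁) : StripRegular (fun p => G₁ p * G₂ p) κ (M₁ * M₂) := by
  refine ⟨h₁.cont.mul h₂.cont, fun i q hq => (h₁.diff i q hq).mul (h₂.diff i q hq), ?_, ?_⟩
  · intro i q hq y hy
    show _ = _
    rw [h₁.sides i q hq y hy, h₂.sides i q hq y hy]
  · intro p hp
    rw [norm_mul]
    exact mul_le_mul (h₁.bound p hp) (h₂.bound p hp) (norm_nonneg _) hM₁

/-- SUMS of strip-regular symbols are strip regular, with the sum of the bounds. [folklore] -/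
theorem StripRegular.add {G₁ G₂ : (Fin (d + 1) → ℂ) → ℂ} {κ M₁ M₂ : ℝ} (h₁ : StripRegular G₁ κ M₁)
    (h₂ : StripRegular G₂ κ M₂) : StripRegular (fun p => G₁ p + G₂ p) κ (M₁ + M₂) := by
  refine ⟨h₁.cont.add h₂.cont, fun i q hq => (h₁.diff i q hq).add (h₂.diff i q hq), ?_, ?_⟩
  · intro i q hq y hy
    show _ = _
    rw [h₁.sides i q hq y hy, h₂.sides i q hq y hy]
  · intro p hp
    exact (norm_add_le _ _).trans (add_le_add (h₁.bound p hp) (h₂.bound p hp))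

/-- INVERSE OF A SYMBOL BOUNDED BELOW (the shape of every instantiation: B4's `1/E(p′)`, B5's `1/m(p′) = E²/𝒩` with
`c ≤ |m| ≤ C` on the strip from `B5Strip145Leaves.uniformStrip145_holds`): if `F` is continuous on the strip, slice
holomorphic, side matching, and `|F| ≥ c > 0` on the strip, then `1/F` is strip regular with bound `1/c`. [folklore] -/
theorem stripRegular_inv {F : (Fin (d + 1) → ℂ) → ℂ} {κ c : ℝ} (hκ : 0 ≤ κ) (hc : 0 < c)
    (cont : ContinuousOn F (Strip (d + 1) κ))
    (diff : ∀ (i : Fin (d + 1)) (q : Fin d → ℝ), q ∈ BZ d →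
      DifferentiableOn ℂ (fun z => F (i.insertNth z (ofRealVec q))) (openRect κ))
    (sides : ∀ (i : Fin (d + 1)) (q : Fin d → ℝ), q ∈ BZ d → ∀ y : ℝ, |y| ≤ κ →
      F (i.insertNth (-π + y * I) (ofRealVec q)) = F (i.insertNth (π + y * I) (ofRealVec q)))
    (lower : ∀ p ∈ Strip (d + 1) κ, c ≤ ‖F p‖) :
    StripRegular (fun p => (F p)⁻¹) κ c⁻¹ := by
  have hne : ∀ p ∈ Strip (d + 1) κ, F p ≠ 0 := fun p hp =>
    norm_pos_iff.mp (lt_of_lt_of_le hc (lower p hp))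
  refine ⟨cont.inv₀ hne, ?_, ?_, ?_⟩
  · intro i q hq
    refine (diff i q hq).inv ?_
    intro z hz
    exact hne _ (insertNth_mem_Strip hκ i hq (openRect_subset_closedRect κ hz))
  · intro i q hq y hy
    show _ = _
    rw [sides i q hq y hy]
  · intro p hp
    rw [norm_inv]
    exact inv_anti₀ hc (lower p hp)

/-- THE INSTANTIATION SHAPE, stated once: a symbol `F` continuous on the strip of half-width `κ ≥ 0`, slice holomorphic,
side matching and bounded below by `c > 0` there has an inverse whose lattice kernel decays:
`|((2π)^{-(d+1)} ∫_{[-π,π]^{d+1}} F(p)⁻¹ e^{ip·x} dp)| ≤ c⁻¹ e^{−κ|x|_∞}` — e.g. B5 (1.45)/(1.126) with `F = m(p′)`,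
uniformly in the block size because `κ, c` are. [folklore] -/
theorem latticeKernel_inv_decay {F : (Fin (d + 1) → ℂ) → ℂ} {κ c : ℝ} (hκ : 0 ≤ κ) (hc : 0 < c)
    (cont : ContinuousOn F (Strip (d + 1) κ))
    (diff : ∀ (i : Fin (d + 1)) (q : Fin d → ℝ), q ∈ BZ d →
      DifferentiableOn ℂ (fun z => F (i.insertNth z (ofRealVec q))) (openRect κ))
    (sides : ∀ (i : Fin (d + 1)) (q : Fin d → ℝ), q ∈ BZ d → ∀ y : ℝ, |y| ≤ κ →
      F (i.insertNth (-π + y * I) (ofRealVec q)) = F (i.insertNth (π + y * I) (ofRealVec q)))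
    (lower : ∀ p ∈ Strip (d + 1) κ, c ≤ ‖F p‖) (x : Fin (d + 1) → ℤ) :
    ‖latticeKernel (fun p => (F p)⁻¹) x‖ ≤ c⁻¹ * Real.exp (-(κ * supNorm x)) :=
  latticeKernel_decay (stripRegular_inv hκ hc cont diff sides lower) hκ x

end

end Literature.MathematicalPhysics.QuantumFieldTheory.Balaban1983to89.B4ContourShift
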